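import Literature.NumberTheory.Automorphic.SmoothRepresentation   -- ★ `Representation.IsSmooth`, `stabilizerSubgroup`, `fixedPoints`, `mem_fixedPoints_iff_le_stabilizerSubgroup`
import Mathlib.RepresentationTheory.Irreducible
import Mathlib.Analysis.SpecificLimits.Basic
import HarnessLib

/-!
# Crux `H413` — K2-LIT E3 «EllipticInputs», U12-h [Assembly] helpers: the occurrence level of an irreducible smooth representation, the two numeric choices of the
# depth-halving assembly (`D` with `C ≤ cst·ε·q^D`, `ν ≥ ν₀` with `C·(q^ν)⁻¹ < cst·ε`), and slice bookkeeping

Cell `hodgecm-mathlib`, Track B «K2-LIT», crux item `stmt-HodgeConjecture-24833` (h413), line `K2_E3_EllipticInputs`, unit U12 «HC characters», socket U12-h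
`sig_K2E3CharLocConstNearRegular` (‹#9L›).  Seat K2E3-p09 (g2), 9L line lead; [Assembly] row of memo v5 `K2/K2E3-p09/g2/MEMO-U12h-frame-assembly.v5.K2E3-p09-g2.md`;
`--supports stmt-HodgeConjecture-24833 --as helper`.  THEOREMS ONLY — no `def`, no named fact, no instance, no notation, no `sorry`.  GENERIC.  HONEST LABEL: HC_CM is proved only
modulo the 7 printed citations (2 remaining named inputs: hLiu418 = stmt-HodgeConjecture-24832, h413 = stmt-HodgeConjecture-24833) until rung 0 closes; count-neutral plumbing.

* §1 **`exists_ne_zero_mem_fixedPoints_of_basis`** — (Adm) of memo v5: an irreducible smooth `ρ` has a non-zero vector fixed by some member `Kf ν₀` of any family of subgroups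
  that is cofinal among open subgroups («`hbasis`» of ★ p855853): `V ≠ 0` (irreducible ⇒ simple module ⇒ non-trivial), the stabiliser of `v₀ ≠ 0` is open (smooth), so it contains
  some `Kf ν₀` [HarishChandra1999, §15 «if `K₀` is sufficiently small, `V₀ ≠ {0}`»]; and `exists_ne_zero_mem_fixedPoints_of_basis_le` (the same below any prescribed index).
* §2 numerics: `exists_nat_le_mul_pow` (`∃ D, C ≤ a·q^D`), `exists_nat_ge_mul_inv_pow_lt` (`∃ ν ≥ ν₀, C·(q^ν)⁻¹ < a`) for `q > 1`, `a > 0`.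
* §3 slice bookkeeping: `forall_mem_image_mul_iff` — a statement over `𝒰₀ = γ·T₁` is a statement over `t ∈ T₁`.

## References
* [HarishChandra1999] Harish-Chandra (notes by S. DeBacker and P. J. Sally, Jr.), *Admissible Invariant Distributions on Reductive p-adic Groups*, ULECT 16, AMS (1999): §15.
* [BernsteinZelevinsky1976] I. N. Bernstein, A. V. Zelevinsky, Russian Math. Surveys 31:3 (1976), §2.1 (smooth vectors have open stabilisers).
-/

set_option autoImplicit false
-- the mandated namespace repeats `HodgeConjecture.HodgeConjecture`, as in every `Theorems/*.lean` of this sub-problem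
set_option linter.dupNamespace false

noncomputable section

open Topology Filter Set

namespace Summit.HodgeConjecture.HodgeConjecture.Cruxes.H413.K2E3AssemblyHelpers

/-! ## §1 (Adm) The occurrence level of an irreducible smooth representation -/

section Occurrence

variable {k G V : Type*} [Field k] [Group G] [TopologicalSpace G] [AddCommGroup V] [Module k V] (ρ : Representation k G V)

/-- **An irreducible smooth representation has a non-zero vector fixed by a deep member of any cofinal family of subgroups**: for `Kf : ℕ → Subgroup G` such that every OPEN
subgroup contains some `Kf M`, there are `ν₀` and `v₀ ≠ 0` with `v₀ ∈ V^{Kf ν₀}` (irreducible ⇒ `V ≠ 0`; smooth ⇒ the stabiliser of `v₀` is an open subgroup).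
[cite: HarishChandra1999, §15] [cite: BernsteinZelevinsky1976, §2.1] -/
theorem exists_ne_zero_mem_fixedPoints_of_basis [ρ.IsIrreducible] (hρ : ρ.IsSmooth) (Kf : ℕ → Subgroup G)
    (hbasis : ∀ K' : Subgroup G, IsOpen (K' : Set G) → ∃ M, Kf M ≤ K') :
    ∃ (ν₀ : ℕ) (v₀ : V), v₀ ≠ 0 ∧ v₀ ∈ ρ.fixedPoints (Kf ν₀) := by
  haveI : Nontrivial ρ.asModule := IsSimpleModule.nontrivial (MonoidAlgebra k G) ρ.asModule
  obtain ⟨v₀, hv₀⟩ := exists_ne (0 : ρ.asModule)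
  obtain ⟨M, hM⟩ := hbasis (ρ.stabilizerSubgroup (ρ.asModuleEquiv v₀)) (hρ _)
  refine ⟨M, ρ.asModuleEquiv v₀, fun h => hv₀ ((LinearEquiv.map_eq_zero_iff _).1 h), ?_⟩
  exact (ρ.mem_fixedPoints_iff_le_stabilizerSubgroup _ _).2 hM

/-- The same below any prescribed index: if the family is antitone, `v₀` is fixed by `Kf ν` for every `ν ≥ ν₀`. [cite: HarishChandra1999, §15] -/
theorem exists_ne_zero_mem_fixedPoints_of_basis_le [ρ.IsIrreducible] (hρ : ρ.IsSmooth) (Kf : ℕ → Subgroup G) (hanti : ∀ m m', m ≤ m' → Kf m' ≤ Kf m)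
    (hbasis : ∀ K' : Subgroup G, IsOpen (K' : Set G) → ∃ M, Kf M ≤ K') :
    ∃ (ν₀ : ℕ) (v₀ : V), v₀ ≠ 0 ∧ ∀ ν, ν₀ ≤ ν → v₀ ∈ ρ.fixedPoints (Kf ν) := by
  obtain ⟨ν₀, v₀, hv₀, hmem⟩ := exists_ne_zero_mem_fixedPoints_of_basis ρ hρ Kf hbasis
  exact ⟨ν₀, v₀, hv₀, fun ν hν => ρ.fixedPoints_antitone (hanti ν₀ ν hν) hmem⟩

end Occurrence

/-! ## §2 The two numeric choices -/

section Numerics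

/-- **`∃ D : ℕ, C ≤ a · q^D`** for `q > 1`, `a > 0` (powers of `q` are unbounded). [folklore] -/
theorem exists_nat_le_mul_pow {q a C : ℝ} (hq : 1 < q) (ha : 0 < a) : ∃ D : ℕ, C ≤ a * q ^ D := by
  obtain ⟨D, hD⟩ := pow_unbounded_of_one_lt (C / a) hq
  exact ⟨D, by rw [div_lt_iff₀ ha] at hD; linarith [hD, mul_comm a (q ^ D)]⟩

/-- **`∃ ν ≥ ν₀, C · (q^ν)⁻¹ < a`** for `q > 1`, `a > 0` (`(q^ν)⁻¹ → 0`): the choice of the depth `ν` of `K₁ = Kf ν` in the assembly (`C q^{−ν} < cst·ε`, `Kf ν ≤ K₀′`).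
[folklore] -/
theorem exists_nat_ge_mul_inv_pow_lt {q a C : ℝ} (hq : 1 < q) (ha : 0 < a) (ν₀ : ℕ) : ∃ ν : ℕ, ν₀ ≤ ν ∧ C * (q ^ ν)⁻¹ < a := by
  have hq0 : 0 < q := zero_lt_one.trans hq
  by_cases hC : C ≤ 0
  · exact ⟨ν₀, le_rfl, (mul_nonpos_of_nonpos_of_nonneg hC (inv_nonneg.2 (pow_nonneg hq0.le _))).trans_lt ha⟩
  push Not at hC
  obtain ⟨n, hn⟩ := pow_unbounded_of_one_lt (C / a) hq
  refine ⟨max n ν₀, le_max_right _ _, ?_⟩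
  have hpow : q ^ n ≤ q ^ max n ν₀ := pow_le_pow_right₀ hq.le (le_max_left _ _)
  have hlt : C / a < q ^ max n ν₀ := hn.trans_le hpow
  have hqpos : 0 < q ^ max n ν₀ := pow_pos hq0 _
  rw [div_lt_iff₀ ha] at hlt
  rw [mul_inv_lt_iff₀ hqpos]
  linarith [mul_comm a (q ^ max n ν₀)]

end Numerics

/-! ## §3 Slice bookkeeping -/

section Slice

variable {G : Type*} [Group G]

/-- A statement about the points of the slice `𝒰₀ = γ · T₁` is a statement about `t ∈ T₁`. [folklore] -/
theorem forall_mem_image_mul_iff (γ : G) (T₁ : Set G) (P : G → Prop) : (∀ y ∈ (fun t => γ * t) '' T₁, P y) ↔ ∀ t ∈ T₁, P (γ * t) := by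
  simp only [Set.mem_image, forall_exists_index, and_imp, forall_apply_eq_imp_iff₂]

/-- Conjugates of the slice: `y = x (γ t) x⁻¹` with `t ∈ T₁`, `x ∈ K₁` ⇒ `∃ y₀ ∈ γ·T₁, ∃ x ∈ K₁, y = x y₀ x⁻¹` (the `h𝒰` binder of ★ p855853). [folklore] -/
theorem exists_mem_image_mul_conj {K₁ : Subgroup G} {γ : G} {T₁ : Set G} {y : G} (h : ∃ t ∈ T₁, ∃ x ∈ K₁, y = x * (γ * t) * x⁻¹) :
    ∃ y₀ ∈ (fun t => γ * t) '' T₁, ∃ x ∈ K₁, y = x * y₀ * x⁻¹ := by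
  obtain ⟨t, ht, x, hx, rfl⟩ := h
  exact ⟨γ * t, Set.mem_image_of_mem _ ht, x, hx, rfl⟩

end Slice

end Summit.HodgeConjecture.HodgeConjecture.Cruxes.H413.K2E3AssemblyHelpers

end
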